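import Literature.Probability.RandomPlanarGeometry.SAWQuantitativeHW
import Literature.Combinatorics.Enumerative.DistinctPartitionsSharp
import Mathlib.Analysis.SpecialFunctions.Pow.Real
import HarnessLib

/-!
# Quantitative Hammersley–Welsh from a windowed bridge height decay, PRODUCT form with explicit constants:
# `c_N ≤ exp(π√(2N/(3ℓ)) + π²/(3ℓ) + 1) · μ^{N+1}` (every `d`, window at aspect ratio `1/ℓ`)

Topic `Literature/Probability/RandomPlanarGeometry`, continuing `SAWQuantitativeHW.lean` (Hutchcroft 2018, hypothesis
(1.1) windowed as `Zd.BridgeHeightDecayWindow d ℓ A c`, Lemma 2.4 `Zd.brGF_subcrit_le_pow`, and the finite Theorem 1.4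
`Zd.count_le_of_heightDecayWindow : c_N ≤ exp(2ρ/(1-ρ)) μ^{N+1}/(1-ε)^{N+1}`).

Sources: T. Hutchcroft, *The Hammersley–Welsh bound for self-avoiding walk revisited*, Electron. Commun. Probab. 23
(2018), Theorem 1.4 ("`c_n ≤ exp[Ψ(n) - 2] μ_c^{n+1}` for every `n ≥ 0`") and its proof (§2: "`Σ_n h_n z^n ≤
Π_A (1 + a(z;A))`", Lemma 2.4, eq. (2.4)); N. Madras, G. Slade, *The Self-Avoiding Walk* (1993), §3.1: Theorem 3.1.1
(Hammersley–Welsh, `B > π(2/3)^{1/2}`), Theorem 3.1.4 (`log P_D(A) ~ π(A/3)^{1/2}`), eqs. (3.1.12)–(3.1.13).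

What is new in THIS FILE (lane pcv-sawmu, items X19b/R6.3; not in print): keeping Hutchcroft's bound as a PRODUCT
`Π_a (1 + ρ^a)` and bounding it by the Euler-product estimate `exp(π²/(12(-log ρ)))`
(`Literature.Combinatorics.Enumerative.sum_log_one_add_exp_le`) instead of `exp(Σ_a ρ^a) = exp(ρ/(1-ρ))` turns the
finite Theorem 1.4 into an EFFECTIVE bound whose `√N`-constant under a window at aspect ratio `1/ℓ` is
`π√(2/(3ℓ))` — at `ℓ = 1` exactly Hammersley–Welsh's `π(2/3)^{1/2}` with an explicit additive constant, at `ℓ = 2`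
(Duminil-Copin–Hammond sub-ballisticity, made explicit on `ℤ²` by the lane's certificates) `π(1/3)^{1/2}`.

## Contents (namespace `Literature.Probability.RandomPlanarGeometry.SAW.Zd`), all PROVED
* `sum_halfSpaceCount_le_prod` — `Σ_{n≤M} h_n z^n ≤ Π_{a<M}(1 + ρ^{a+1})` given `V_M(z;a) ≤ ρ^a`;
* `prod_one_add_pow_le_exp` — `Π_{a<M}(1 + ρ^{a+1}) ≤ exp(π²/(12(-log ρ)))`;
* `count_mul_pow_le_sq` — `c_N z^{N+1} ≤ (Σ_{n≤N+1} h_n z^n)²`;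
* `mul_exp_neg_le_pow_of_regime` — the regime `(ℓ-1)ε' ≤ c(1-ε') ⇒ (1-ε')e^{-c} ≤ (1-ε')^ℓ`;
* **`count_le_of_window_prod`** — `c_N ≤ exp(π²/(6ℓε')) μ^{N+1}/(1-ε')^{N+1}` (every `N`, every admissible `ε'`);
* **`count_le_exp_sharp_of_window`** — `c_N ≤ exp(π√(2N/(3ℓ)) + π²/(3ℓ) + 1) μ^{N+1}` (`2π² ≤ 3ℓN`,
  `π²((ℓ-1)/c+1)² ≤ 6ℓN`).
(Statements typed by the lane's planner a-idea-1, Sketch_G3_ExplicitHW.lean v2.1 / Sketch_G3_R63a_skeleton.lean v2;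
proofs a-p3.)
-/

open Finset
open Literature.Probability.RandomPlanarGeometry.SAW
open scoped BigOperators

namespace Literature.Probability.RandomPlanarGeometry.SAW.Zd

variable {d : ℕ} [NeZero d]

/-- **Product form of the half-space bound** (the step "`Σ_N h_N z^N ≤ Π_A (1 + Σ_m b_{m,A} z^m)`" of
Madras–Slade's proof of Corollary 3.1.8 / Hutchcroft's proof of Theorem 1.4, kept as a PRODUCT instead of
`exp Σ`): if every span-`a` bridge generating function satisfies `V_M(z;a) ≤ ρ^a` (`a ≥ 1`), then
`Σ_{n≤M} h_n z^n ≤ Π_{a<M}(1 + ρ^{a+1})`. [cite: MadrasSlade1993, §3.1, proof of Corollary 3.1.8 (eq. (3.1.12)); Hutchcroft2018HammersleyWelsh, proof of Theorem 1.4] -/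
theorem sum_halfSpaceCount_le_prod (M : ℕ) {z ρ : ℝ} (hz : 0 ≤ z) (hρ : 0 ≤ ρ)
    (hV : ∀ a : ℕ, 1 ≤ a → Zd.brGF d M z a ≤ ρ ^ a) :
    ∑ n ∈ Finset.range (M + 1), (Zd.halfSpaceCount d n : ℝ) * z ^ n ≤
      ∏ a ∈ Finset.range M, (1 + ρ ^ (a + 1)) := by
  classical
  -- every half-space walk of length `n ≤ M` has span `≤ n < M + 1`: the sum is `T_M(M+1)`
  have hT : ∑ n ∈ Finset.range (M + 1), (Zd.halfSpaceCount d n : ℝ) * z ^ n =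
      Zd.hsLTGF d M z (M + 1 : ℕ) := by
    refine Finset.sum_congr rfl fun n hn => ?_
    rw [Finset.mem_range] at hn
    congr 2
    rw [Zd.halfSpaceCount, Zd.hsSpanLT, Finset.filter_true_of_mem]
    intro ω hω
    obtain ⟨h00, -, hadj, -⟩ := Zd.mem_saws.1 (Zd.mem_halfSpaceWalks.1 hω).1
    have hml : Zd.maxLevel n ω ≤ (n : ℤ) := Zd.maxLevel_le fun i hi =>
      (le_abs_self _).trans ((Zd.abs_apply_le_of_adj h00 hadj i hi 0).trans (by exact_mod_cast hi))
    have hnM : (n : ℤ) < ((M + 1 : ℕ) : ℤ) := by exact_mod_cast hn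
    exact lt_of_le_of_lt hml hnM
  rw [hT]
  -- induction on the span: `T(k+1) ≤ Π_{a<k} (1 + ρ^{a+1})`
  have key : ∀ k : ℕ, Zd.hsLTGF d M z (k + 1 : ℕ) ≤ ∏ a ∈ Finset.range k, (1 + ρ ^ (a + 1)) := by
    intro k
    induction k with
    | zero =>
      simp only [Nat.zero_add, Nat.cast_one, Finset.range_zero, Finset.prod_empty]
      exact Zd.hsLTGF_one_le M z
    | succ k ih =>
      have hT0 : 0 ≤ Zd.hsLTGF d M z (k + 1 : ℕ) := Finset.sum_nonneg fun n _ => by positivity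
      have hP0 : 0 ≤ ∏ a ∈ Finset.range k, (1 + ρ ^ (a + 1)) :=
        Finset.prod_nonneg fun a _ => by positivity
      have hVk : Zd.brGF d M z (k + 1 : ℕ) ≤ ρ ^ (k + 1) := hV (k + 1) (by omega)
      rw [Finset.prod_range_succ, show ((k + 1 + 1 : ℕ) : ℤ) = ((k + 1 : ℕ) : ℤ) + 1 by push_cast; ring,
        Zd.hsLTGF_succ]
      calc Zd.hsLTGF d M z (k + 1 : ℕ) +
            ∑ n ∈ Finset.range (M + 1), ((Zd.hsSpan d n (k + 1 : ℕ)).card : ℝ) * z ^ n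
          ≤ Zd.hsLTGF d M z (k + 1 : ℕ) + Zd.brGF d M z (k + 1 : ℕ) * Zd.hsLTGF d M z (k + 1 : ℕ) := by
            gcongr
            exact Zd.sum_hsSpan_le M hz (by exact_mod_cast Nat.succ_pos k)
        _ = Zd.hsLTGF d M z (k + 1 : ℕ) * (1 + Zd.brGF d M z (k + 1 : ℕ)) := by ring
        _ ≤ (∏ a ∈ Finset.range k, (1 + ρ ^ (a + 1))) * (1 + ρ ^ (k + 1)) := by
            have hB0 : 0 ≤ Zd.brGF d M z (k + 1 : ℕ) := Finset.sum_nonneg fun n _ => by positivity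
            exact mul_le_mul ih (by linarith) (by linarith) hP0
  exact key M

/-- Euler-product bound (from `Literature.Combinatorics.Enumerative.sum_log_one_add_exp_le`, the engine of the
sharp count of partitions into distinct parts, Madras–Slade Theorem 3.1.4): `Π_{a<M}(1 + ρ^{a+1}) ≤ exp(π²/(12·(-log ρ)))`
for `0 < ρ < 1`. [cite: MadrasSlade1993, Theorem 3.1.4 (proof: `log Π (1 + x^k) ≤ π²/(12(-log x))`)] -/
theorem prod_one_add_pow_le_exp {ρ : ℝ} (hρ0 : 0 < ρ) (hρ1 : ρ < 1) (M : ℕ) :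
    ∏ a ∈ Finset.range M, (1 + ρ ^ (a + 1)) ≤ Real.exp (Real.pi ^ 2 / (12 * (-Real.log ρ))) := by
  set t : ℝ := -Real.log ρ with ht
  have ht0 : 0 < t := by rw [ht, neg_pos]; exact Real.log_neg hρ0 hρ1
  have hρt : ρ = Real.exp (-t) := by rw [ht, neg_neg, Real.exp_log hρ0]
  have hre : ∀ K : ℕ, ∑ a ∈ Finset.range K, Real.log (1 + ρ ^ (a + 1)) =
      ∑ k ∈ Finset.Icc 1 K, Real.log (1 + Real.exp (-t) ^ k) := by
    intro K
    rw [← hρt]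
    induction K with
    | zero => simp
    | succ K ih =>
      rw [Finset.sum_range_succ, Finset.sum_Icc_succ_top (by omega), ih]
  have hpos : ∀ a ∈ Finset.range M, 0 < 1 + ρ ^ (a + 1) := fun a _ => by positivity
  rw [← Real.exp_log (Finset.prod_pos hpos), Real.exp_le_exp, Real.log_prod (fun a ha => (hpos a ha).ne')]
  -- reindex `a + 1 = k ∈ [1, M]` and apply the Euler-product bound
  rw [hre M]
  exact Literature.Combinatorics.Enumerative.sum_log_one_add_exp_le ht0 M

/-- **`c_N z^{N+1} ≤ (Σ_{n≤N+1} h_n z^n)²`** for `z ≥ 0` — one row of Madras–Slade (3.1.13)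
(`c_N ≤ Σ_m h_{m+1} h_{N-m}`, `Zd.count_le_sum_halfSpaceCount`). [cite: MadrasSlade1993, §3.1, eq. (3.1.13); Hutchcroft2018HammersleyWelsh, Proposition 2.1] -/
theorem count_mul_pow_le_sq (N : ℕ) {z : ℝ} (hz : 0 ≤ z) :
    (Zd.count d N : ℝ) * z ^ (N + 1) ≤
      (∑ n ∈ Finset.range (N + 2), (Zd.halfSpaceCount d n : ℝ) * z ^ n) ^ 2 := by
  set H : ℝ := ∑ n ∈ Finset.range (N + 2), (Zd.halfSpaceCount d n : ℝ) * z ^ n with hH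
  have hH0 : ∀ n, (0 : ℝ) ≤ (Zd.halfSpaceCount d n : ℝ) * z ^ n := fun n => by positivity
  -- `c_N z^{N+1} ≤ Σ_m (h_{m+1} z^{m+1}) (h_{N-m} z^{N-m})`
  have hc : (Zd.count d N : ℝ) ≤ ∑ m ∈ Finset.range (N + 1),
      (Zd.halfSpaceCount d (m + 1) : ℝ) * Zd.halfSpaceCount d (N - m) := by
    exact_mod_cast Zd.count_le_sum_halfSpaceCount (d := d) N
  have h1 : (Zd.count d N : ℝ) * z ^ (N + 1) ≤ ∑ m ∈ Finset.range (N + 1),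
      ((Zd.halfSpaceCount d (m + 1) : ℝ) * z ^ (m + 1)) *
        ((Zd.halfSpaceCount d (N - m) : ℝ) * z ^ (N - m)) := by
    calc (Zd.count d N : ℝ) * z ^ (N + 1)
        ≤ (∑ m ∈ Finset.range (N + 1),
            (Zd.halfSpaceCount d (m + 1) : ℝ) * Zd.halfSpaceCount d (N - m)) * z ^ (N + 1) :=
          mul_le_mul_of_nonneg_right hc (pow_nonneg hz _)
      _ = _ := by
          rw [Finset.sum_mul]
          refine Finset.sum_congr rfl fun m hm => ?_
          rw [Finset.mem_range] at hm
          rw [show z ^ (N + 1) = z ^ (m + 1) * z ^ (N - m) by rw [← pow_add]; congr 1; omega]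
          ring
  -- the single row `n = N` of the triangle is bounded by the whole triangle, hence by the product
  have h2 : ∑ m ∈ Finset.range (N + 1),
      ((Zd.halfSpaceCount d (m + 1) : ℝ) * z ^ (m + 1)) * ((Zd.halfSpaceCount d (N - m) : ℝ) * z ^ (N - m)) ≤
      ∑ n ∈ Finset.range (N + 1), ∑ m ∈ Finset.range (n + 1),
        ((Zd.halfSpaceCount d (m + 1) : ℝ) * z ^ (m + 1)) * ((Zd.halfSpaceCount d (n - m) : ℝ) * z ^ (n - m)) := by
    have hmem : N ∈ Finset.range (N + 1) := Finset.self_mem_range_succ N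
    exact Finset.single_le_sum (f := fun n => ∑ m ∈ Finset.range (n + 1),
        ((Zd.halfSpaceCount d (m + 1) : ℝ) * z ^ (m + 1)) * ((Zd.halfSpaceCount d (n - m) : ℝ) * z ^ (n - m)))
      (fun n _ => Finset.sum_nonneg fun m _ => mul_nonneg (hH0 _) (hH0 _)) hmem
  have h3 := Zd.sum_range_triangle_le (f := fun m => (Zd.halfSpaceCount d (m + 1) : ℝ) * z ^ (m + 1))
    (g := fun k => (Zd.halfSpaceCount d k : ℝ) * z ^ k) (fun i => hH0 (i + 1)) (fun i => hH0 i) N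
  have h4 : ∑ m ∈ Finset.range (N + 1), (Zd.halfSpaceCount d (m + 1) : ℝ) * z ^ (m + 1) ≤ H := by
    rw [hH, Finset.sum_range_succ' _ (N + 1)]
    linarith [hH0 0]
  have h5 : ∑ k ∈ Finset.range (N + 1), (Zd.halfSpaceCount d k : ℝ) * z ^ k ≤ H := by
    rw [hH, Finset.sum_range_succ _ (N + 1)]
    linarith [hH0 (N + 1)]
  have hHnn : 0 ≤ H := Finset.sum_nonneg fun n _ => hH0 n
  have hA0 : 0 ≤ ∑ m ∈ Finset.range (N + 1), (Zd.halfSpaceCount d (m + 1) : ℝ) * z ^ (m + 1) :=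
    Finset.sum_nonneg fun m _ => hH0 _
  calc (Zd.count d N : ℝ) * z ^ (N + 1) ≤ _ := h1
    _ ≤ _ := h2
    _ ≤ _ := h3
    _ ≤ H * H := mul_le_mul h4 h5 (Finset.sum_nonneg fun k _ => hH0 k) hHnn
    _ = H ^ 2 := (sq H).symm

/-- The regime inequality: `(ℓ-1)ε' ≤ c(1-ε')` with `ε' < 1`, `ℓ ≥ 1` ⇒ `(1-ε') e^{-c} ≤ (1-ε')^ℓ`
(so that Hutchcroft's rate `max((1-ε')^ℓ, (1-ε')e^{-c})` of (2.4) is `(1-ε')^ℓ`).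
[cite: Hutchcroft2018HammersleyWelsh, Lemma 2.4, eq. (2.4)] -/
theorem mul_exp_neg_le_pow_of_regime {ℓ : ℕ} (hℓ : 1 ≤ ℓ) {c ε' : ℝ} (hε1 : ε' < 1)
    (hreg : ((ℓ : ℝ) - 1) * ε' ≤ c * (1 - ε')) :
    (1 - ε') * Real.exp (-c) ≤ (1 - ε') ^ ℓ := by
  have h1ε : 0 < 1 - ε' := by linarith
  have hL1 : (0 : ℝ) ≤ (ℓ : ℝ) - 1 := by
    have : (1 : ℝ) ≤ (ℓ : ℝ) := by exact_mod_cast hℓ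
    linarith
  -- `-log(1-ε') ≤ ε'/(1-ε')` (from `log x ≤ x - 1` at `x = 1/(1-ε')`)
  have hlog : -Real.log (1 - ε') ≤ ε' / (1 - ε') := by
    have h := Real.log_le_sub_one_of_pos (inv_pos.2 h1ε)
    rw [Real.log_inv] at h
    have e : (1 - ε')⁻¹ - 1 = ε' / (1 - ε') := by field_simp; ring
    linarith
  -- hence `-c ≤ (ℓ-1) log(1-ε')`
  have hc : -c ≤ ((ℓ : ℝ) - 1) * Real.log (1 - ε') := by
    have h2 : ((ℓ : ℝ) - 1) * (ε' / (1 - ε')) ≤ c := by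
      rw [mul_div_assoc', div_le_iff₀ h1ε]; linarith
    nlinarith [mul_le_mul_of_nonneg_left hlog hL1]
  -- exponentiate: `e^{-c} ≤ (1-ε')^{ℓ-1}`
  obtain ⟨m, rfl⟩ : ∃ m, ℓ = m + 1 := ⟨ℓ - 1, by omega⟩
  have hpow : Real.exp (-c) ≤ (1 - ε') ^ m := by
    have : Real.exp (((m : ℕ) : ℝ) * Real.log (1 - ε')) = (1 - ε') ^ m := by
      rw [Real.exp_nat_mul, Real.exp_log h1ε]
    rw [← this, Real.exp_le_exp]
    have hm : (((m + 1 : ℕ) : ℝ) - 1) = (m : ℝ) := by push_cast; ring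
    rw [hm] at hc
    exact hc
  calc (1 - ε') * Real.exp (-c) ≤ (1 - ε') * (1 - ε') ^ m :=
        mul_le_mul_of_nonneg_left hpow h1ε.le
    _ = (1 - ε') ^ (m + 1) := by ring

/-- **Hutchcroft's Theorem 1.4 in PRODUCT form with explicit constants** (sharpening the tree's finite form
`Zd.count_le_of_heightDecayWindow`, whose exponent is `2ρ/(1-ρ)`): under the windowed height-decay hypothesis
`Zd.BridgeHeightDecayWindow d ℓ A c` (`ℓ ≥ 1`), for every `0 < ε' < 1` in the regime `(ℓ-1)ε' ≤ c(1-ε')`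
and EVERY `N`: `c_N ≤ exp(π²/(6ℓε')) · μ^{N+1}/(1-ε')^{N+1}`. The constant `π²/(6ℓε')` is this file's (not printed):
it comes from the Euler product `Π_a (1 + ρ^a) ≤ exp(π²/(12(-log ρ)))` with `ρ = (1-ε')^ℓ`, `-log ρ ≥ ℓε'`.
[cite: Hutchcroft2018HammersleyWelsh, Theorem 1.4 and Lemma 2.4 (windowed hypothesis, product form)] -/
theorem count_le_of_window_prod {ℓ : ℕ} {A c : ℝ}
    (h : Zd.BridgeHeightDecayWindow d ℓ A c) (hℓ : 1 ≤ ℓ)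
    {ε' : ℝ} (hε0 : 0 < ε') (hε1 : ε' < 1) (hreg : ((ℓ : ℝ) - 1) * ε' ≤ c * (1 - ε')) (N : ℕ) :
    (Zd.count d N : ℝ) ≤
      Real.exp (Real.pi ^ 2 / (6 * (ℓ : ℝ) * ε')) *
        Zd.connectiveConstant d ^ (N + 1) / (1 - ε') ^ (N + 1) := by
  have hμ : 0 < Zd.connectiveConstant d := Zd.connectiveConstant_pos d
  have h1ε : 0 < 1 - ε' := by linarith
  set z : ℝ := (1 - ε') * (Zd.connectiveConstant d)⁻¹ with hz
  have hz0 : 0 < z := by positivity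
  set ρ : ℝ := (1 - ε') ^ ℓ with hρ
  have hρ0 : 0 < ρ := pow_pos h1ε ℓ
  have hρ1 : ρ < 1 := pow_lt_one₀ h1ε.le (by linarith) (by omega)
  -- Step A: span rate `V_M(z;a) ≤ ρ^a`
  have hmax : max ((1 - ε') ^ ℓ) ((1 - ε') * Real.exp (-c)) = ρ :=
    max_eq_left (mul_exp_neg_le_pow_of_regime hℓ hε1 hreg)
  have hV : ∀ M a : ℕ, 1 ≤ a → Zd.brGF d M z a ≤ ρ ^ a := by
    intro M a ha
    have key := Zd.brGF_subcrit_le_pow h hℓ hε0 hε1 M ha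
    rw [hmax] at key
    exact key
  -- Step B: `t = -log ρ ≥ ℓ ε'`
  have hlρ : Real.log ρ = (ℓ : ℝ) * Real.log (1 - ε') := by
    rw [hρ, Real.log_pow]
  have hlog1 : Real.log (1 - ε') ≤ -ε' := by
    have := Real.log_le_sub_one_of_pos h1ε
    linarith
  have ht : (ℓ : ℝ) * ε' ≤ -Real.log ρ := by
    rw [hlρ]
    have hℓ0 : (0 : ℝ) ≤ (ℓ : ℝ) := Nat.cast_nonneg ℓ
    nlinarith
  have hℓε : 0 < (ℓ : ℝ) * ε' := by
    have : (1 : ℝ) ≤ (ℓ : ℝ) := by exact_mod_cast hℓ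
    positivity
  have ht0 : 0 < -Real.log ρ := lt_of_lt_of_le hℓε ht
  -- Step C: the half-space sum at `M = N+1`
  have hS : ∑ n ∈ Finset.range (N + 2), (Zd.halfSpaceCount d n : ℝ) * z ^ n ≤
      Real.exp (Real.pi ^ 2 / (12 * (-Real.log ρ))) :=
    (sum_halfSpaceCount_le_prod (N + 1) hz0.le hρ0.le (hV (N + 1))).trans
      (prod_one_add_pow_le_exp hρ0 hρ1 (N + 1))
  have hS0 : 0 ≤ ∑ n ∈ Finset.range (N + 2), (Zd.halfSpaceCount d n : ℝ) * z ^ n :=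
    Finset.sum_nonneg fun n _ => by positivity
  -- Step D: square and compare exponents
  have hexp : Real.pi ^ 2 / (12 * (-Real.log ρ)) * 2 ≤ Real.pi ^ 2 / (6 * (ℓ : ℝ) * ε') := by
    rw [div_mul_eq_mul_div, div_le_div_iff₀ (by positivity) (by positivity)]
    have hπ : 0 ≤ Real.pi ^ 2 := sq_nonneg _
    nlinarith [mul_le_mul_of_nonneg_left ht hπ]
  have hC : (Zd.count d N : ℝ) * z ^ (N + 1) ≤ Real.exp (Real.pi ^ 2 / (6 * (ℓ : ℝ) * ε')) :=
    calc (Zd.count d N : ℝ) * z ^ (N + 1)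
        ≤ (∑ n ∈ Finset.range (N + 2), (Zd.halfSpaceCount d n : ℝ) * z ^ n) ^ 2 :=
          count_mul_pow_le_sq N hz0.le
      _ ≤ (Real.exp (Real.pi ^ 2 / (12 * (-Real.log ρ)))) ^ 2 := pow_le_pow_left₀ hS0 hS 2
      _ = Real.exp (Real.pi ^ 2 / (12 * (-Real.log ρ)) * 2) := by
          rw [← Real.exp_nat_mul]; ring_nf
      _ ≤ Real.exp (Real.pi ^ 2 / (6 * (ℓ : ℝ) * ε')) := Real.exp_le_exp.2 hexp
  -- Step E: divide by `z^{N+1} = (1-ε')^{N+1} μ^{-(N+1)}`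
  have hzpow : z ^ (N + 1) = (1 - ε') ^ (N + 1) / Zd.connectiveConstant d ^ (N + 1) := by
    rw [hz, mul_pow, inv_pow, div_eq_mul_inv]
  rw [hzpow] at hC
  rw [le_div_iff₀ (pow_pos h1ε _)]
  have hμp : 0 < Zd.connectiveConstant d ^ (N + 1) := pow_pos hμ _
  have := mul_le_mul_of_nonneg_right hC hμp.le
  rw [mul_assoc, div_mul_cancel₀ _ hμp.ne'] at this
  linarith [this]

/-- **Explicit Hammersley–Welsh exponent `π√(2/(3ℓ))` from a window at aspect ratio `1/ℓ`** (the choice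
`ε' := π/√(6ℓN)` in `count_le_of_window_prod`): under `Zd.BridgeHeightDecayWindow d ℓ A c` with `c > 0`, for all `N`
with `2π² ≤ 3ℓN` and `π²((ℓ-1)/c + 1)² ≤ 6ℓN`, `c_N ≤ exp(π√(2N/(3ℓ)) + π²/(3ℓ) + 1) · μ^{N+1}`. For `ℓ = 1`
(no hypothesis beyond Lemma 2.3) this is Hammersley–Welsh's `π(2/3)^{1/2}` (Madras–Slade Theorem 3.1.1) made
effective with the additive constant `π²/3 + 1`; for `ℓ ≥ 2` the exponent constant `π√(2/(3ℓ)) < π(2/3)^{1/2}` is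
this file's (print: Hutchcroft's Theorem 1.2 `o(√n)` is ineffective).
[cite: Hutchcroft2018HammersleyWelsh, Theorem 1.4; MadrasSlade1993, Theorem 3.1.1] -/
theorem count_le_exp_sharp_of_window {ℓ : ℕ} {A c : ℝ}
    (h : Zd.BridgeHeightDecayWindow d ℓ A c) (hℓ : 1 ≤ ℓ) (hc : 0 < c) (N : ℕ)
    (hN1 : 2 * Real.pi ^ 2 ≤ 3 * (ℓ : ℝ) * N)
    (hN2 : Real.pi ^ 2 * (((ℓ : ℝ) - 1) / c + 1) ^ 2 ≤ 6 * (ℓ : ℝ) * N) :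
    (Zd.count d N : ℝ) ≤
      Real.exp (Real.pi * Real.sqrt (2 * N / (3 * (ℓ : ℝ))) + Real.pi ^ 2 / (3 * (ℓ : ℝ)) + 1) *
        Zd.connectiveConstant d ^ (N + 1) := by
  -- abbreviations
  have hπ : 0 < Real.pi := Real.pi_pos
  have hL : (1 : ℝ) ≤ (ℓ : ℝ) := by exact_mod_cast hℓ
  have hL0 : (0 : ℝ) < (ℓ : ℝ) := by linarith
  have hn0 : (0 : ℝ) ≤ (N : ℝ) := Nat.cast_nonneg N
  have h6Ln : (0 : ℝ) ≤ 6 * (ℓ : ℝ) * N := by positivity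
  set s : ℝ := Real.sqrt (6 * (ℓ : ℝ) * N) with hs
  have hs2 : s ^ 2 = 6 * (ℓ : ℝ) * N := Real.sq_sqrt h6Ln
  have hs0 : 0 ≤ s := Real.sqrt_nonneg _
  -- `2π ≤ s` from `hN1`, hence `s > π > 0`
  have h2πs : 2 * Real.pi ≤ s := by
    rw [hs, Real.le_sqrt (by positivity) h6Ln]
    nlinarith
  have hsπ : 0 < s - Real.pi := by linarith
  have hspos : 0 < s := by linarith
  -- the choice `ε' = π/s`
  set ε' : ℝ := Real.pi / s with hε'
  have hε0 : 0 < ε' := div_pos hπ hspos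
  have hεhalf : ε' ≤ 1 / 2 := by
    rw [hε', div_le_iff₀ hspos]
    linarith
  have hε1 : ε' < 1 := by linarith
  -- the regime `(ℓ-1)ε' ≤ c(1-ε')` from `hN2`
  have hπs : Real.pi * (((ℓ : ℝ) - 1) / c + 1) ≤ s := by
    have h0 : 0 ≤ Real.pi * (((ℓ : ℝ) - 1) / c + 1) := by
      have : 0 ≤ ((ℓ : ℝ) - 1) / c := div_nonneg (by linarith) hc.le
      positivity
    rw [hs, Real.le_sqrt h0 h6Ln, mul_pow]
    linarith [hN2]
  have hreg' : ((ℓ : ℝ) - 1) * Real.pi ≤ c * (s - Real.pi) := by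
    have e : c * (Real.pi * (((ℓ : ℝ) - 1) / c + 1)) = ((ℓ : ℝ) - 1) * Real.pi + c * Real.pi := by
      field_simp
    linarith [mul_le_mul_of_nonneg_left hπs hc.le, e]
  have hreg : ((ℓ : ℝ) - 1) * ε' ≤ c * (1 - ε') := by
    have e1 : ((ℓ : ℝ) - 1) * ε' = (((ℓ : ℝ) - 1) * Real.pi) / s := by
      rw [hε']; ring
    have e2 : c * (1 - ε') = (c * (s - Real.pi)) / s := by
      rw [hε']; field_simp
    rw [e1, e2]
    exact div_le_div_of_nonneg_right hreg' hs0
  -- R6.3a at this `ε'`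
  have hA := count_le_of_window_prod h hℓ hε0 hε1 hreg N
  -- exponent bookkeeping
  have h1ε : 0 < 1 - ε' := by linarith
  have hμ : 0 < Zd.connectiveConstant d := Zd.connectiveConstant_pos d
  have hμp : 0 < Zd.connectiveConstant d ^ (N + 1) := pow_pos hμ _
  -- `(1-ε')^{-(N+1)} ≤ exp((N+1) ε'/(1-ε'))`
  have hbase : (1 - ε')⁻¹ ≤ Real.exp (ε' / (1 - ε')) := by
    have e : (1 - ε')⁻¹ = ε' / (1 - ε') + 1 := by
      field_simp
      ring
    rw [e]
    exact Real.add_one_le_exp _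
  have hinvpow : ((1 - ε') ^ (N + 1))⁻¹ ≤ Real.exp (((N + 1 : ℕ) : ℝ) * (ε' / (1 - ε'))) := by
    rw [Real.exp_nat_mul, ← inv_pow]
    exact pow_le_pow_left₀ (inv_nonneg.2 h1ε.le) hbase _
  -- the two exponent pieces
  have e1 : Real.pi ^ 2 / (6 * (ℓ : ℝ) * ε') = Real.pi * s / (6 * (ℓ : ℝ)) := by
    rw [hε']
    field_simp
  have e2 : ε' / (1 - ε') = Real.pi / (s - Real.pi) := by
    rw [hε']
    field_simp
  have hpoly : ((N : ℝ) + 1) * Real.pi * (6 * (ℓ : ℝ)) ≤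
      (Real.pi * s + 2 * Real.pi ^ 2 + 6 * (ℓ : ℝ)) * (s - Real.pi) := by
    have hπs2 : Real.pi * s ^ 2 = Real.pi * (6 * (ℓ : ℝ) * N) := by rw [hs2]
    have key := mul_le_mul_of_nonneg_right h2πs (by positivity : (0 : ℝ) ≤ Real.pi ^ 2 + 6 * (ℓ : ℝ))
    linear_combination key - hπs2
  have hB : ((N : ℝ) + 1) * (Real.pi / (s - Real.pi)) ≤
      Real.pi * s / (6 * (ℓ : ℝ)) + Real.pi ^ 2 / (3 * (ℓ : ℝ)) + 1 := by
    rw [mul_div_assoc', div_le_iff₀ hsπ]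
    have e : (Real.pi * s / (6 * (ℓ : ℝ)) + Real.pi ^ 2 / (3 * (ℓ : ℝ)) + 1) * (s - Real.pi) =
        ((Real.pi * s + 2 * Real.pi ^ 2 + 6 * (ℓ : ℝ)) * (s - Real.pi)) / (6 * (ℓ : ℝ)) := by
      field_simp
      ring
    rw [e, le_div_iff₀ (by positivity)]
    linarith [hpoly]
  have hsq : s / (3 * (ℓ : ℝ)) ≤ Real.sqrt (2 * N / (3 * (ℓ : ℝ))) := by
    rw [Real.le_sqrt (by positivity) (by positivity), div_pow, hs2, div_le_div_iff₀ (by positivity) (by positivity)]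
    exact le_of_eq (by ring)
  have hE : Real.pi ^ 2 / (6 * (ℓ : ℝ) * ε') + ((N + 1 : ℕ) : ℝ) * (ε' / (1 - ε')) ≤
      Real.pi * Real.sqrt (2 * N / (3 * (ℓ : ℝ))) + Real.pi ^ 2 / (3 * (ℓ : ℝ)) + 1 := by
    rw [e1, e2, Nat.cast_add, Nat.cast_one]
    have : Real.pi * s / (6 * (ℓ : ℝ)) + Real.pi * s / (6 * (ℓ : ℝ)) = Real.pi * (s / (3 * (ℓ : ℝ))) := by
      field_simp
      ring
    linarith [hB, mul_le_mul_of_nonneg_left hsq hπ.le, this]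
  -- combine
  calc (Zd.count d N : ℝ)
      ≤ Real.exp (Real.pi ^ 2 / (6 * (ℓ : ℝ) * ε')) * Zd.connectiveConstant d ^ (N + 1) /
          (1 - ε') ^ (N + 1) := hA
    _ = Real.exp (Real.pi ^ 2 / (6 * (ℓ : ℝ) * ε')) * Zd.connectiveConstant d ^ (N + 1) *
          ((1 - ε') ^ (N + 1))⁻¹ := by rw [div_eq_mul_inv]
    _ ≤ Real.exp (Real.pi ^ 2 / (6 * (ℓ : ℝ) * ε')) * Zd.connectiveConstant d ^ (N + 1) *
          Real.exp (((N + 1 : ℕ) : ℝ) * (ε' / (1 - ε'))) := by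
        gcongr
    _ = Real.exp (Real.pi ^ 2 / (6 * (ℓ : ℝ) * ε') + ((N + 1 : ℕ) : ℝ) * (ε' / (1 - ε'))) *
          Zd.connectiveConstant d ^ (N + 1) := by
        rw [Real.exp_add]; ring
    _ ≤ Real.exp (Real.pi * Real.sqrt (2 * N / (3 * (ℓ : ℝ))) + Real.pi ^ 2 / (3 * (ℓ : ℝ)) + 1) *
          Zd.connectiveConstant d ^ (N + 1) :=
        mul_le_mul_of_nonneg_right (Real.exp_le_exp.2 hE) hμp.le

end Literature.Probability.RandomPlanarGeometry.SAW.Zd
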